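import Summits.NavierStokesRegularity.NavierStokesRegularity.Theses.AxisymmetricExtremality
import Summits.NavierStokesRegularity.NavierStokesRegularity.Theorems.AxisymmetricExtremalityAxisymmetricKatoGlobalStubSeregin2020TypeIILimitSwirlBound
import Summits.NavierStokesRegularity.NavierStokesRegularity.Theorems.AxisymmetricExtremalityAxisymmetricKatoGlobalStubSeregin2020TypeIISwirlSupBound
import HarnessLib

/-!
# Seregin 2020, proof of Thm 2.1: the axisymmetric ancient (blow-up) limit with bounded swirl,
# unconditionally

Helper toward the stub `stub_seregin2020TypeII` of the crux `AxisymmetricKatoGlobal` (= the named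
fact `Literature.Analysis.FluidPDE.Seregin2020_axisymmetricSingularPoint_typeII`, G. Seregin,
Anal. Math. Phys. 10 (2020) Paper 46 = arXiv:2006.04140, Thm 2.1). The sibling module
`…StubSeregin2020TypeIILimitSwirlBound` produced the blow-up limit `(w, π)` of the printed proof
with all of properties (𝒜) (i)–(iii), the lower bound (2.9) `C(a) ≥ κ > 0`, the singular origin and
the bounded swirl (2.8) `Γ = ϱ u_φ ∈ L_∞(Q₋)` — GIVEN the local bound (2.6)
`sup_{Q(1/2)} |σ| ≤ c(M)` of the swirl of the original solution as a hypothesis. The sibling module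
`…StubSeregin2020TypeIISwirlSupBound` proves (2.6) (`swirl_ae_bounded_half`, the assembled Moser
iteration). This file discharges the hypothesis:

* `exists_ancientLimit_isAxisymmetric_swirl_bounded` — under the hypotheses (H) of Thm 2.1 and the
  Type I assumption `g(0) < ∞`, there are `c`, `K`, `κ > 0`, scales `λⱼ → 0⁺` and a pair `(w, π)`,
  pointwise axisymmetric, singular at the origin, suitable in every `Q(a)` with `A, C, D, A + E ≤ K`,
  `C ≥ κ`, strong `L³`/weak `L^{3/2}` limit of the rescaled pairs, and `|swirl (w s) y| ≤ c` a.e. on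
  every `Q(a)`.

This closes the first half of the printed proof (arXiv pp. 5–7, up to and including (𝒜), (2.8),
(2.9)); what remains of Thm 2.1 is Lemma 2.2, `Γ ≡ 0`, and the no-swirl regularity up to the axis.

## References

* G. Seregin, Anal. Math. Phys. 10 (2020), Paper 46 = arXiv:2006.04140, proof of Thm. 2.1, (2.6),
  (𝒜), (2.8), (2.9) (arXiv p. 7). [Seregin2020]
-/

-- the problem directory repeats the summit name (D-0017); core's `dupNamespace` linter fires
set_option linter.dupNamespace false

noncomputable section

open MeasureTheory Set Function Filter Topology TopologicalSpace Metric
open scoped NNReal ENNReal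

namespace Summit.NavierStokesRegularity.NavierStokesRegularity.Theorems.AxisymmetricKatoGlobal.EulerScaling

open Literature.Analysis.FluidPDE Literature.Analysis.FluidPDE.Seregin2020

/-- **Seregin 2020, proof of Thm 2.1: the blow-up limit with properties (𝒜), (2.8) and (2.9),
unconditionally.** Under the hypotheses of Theorem 2.1 (suitable weak solution `(v, q)` in
`Q = 𝒞 × ]-1, 0[` of the class of Def. 1.3, axisymmetric, singular at the origin) and the Type I
assumption `g(0) < ∞`, there are a constant `c`, a bound `K`, `κ > 0`, scales `λⱼ → 0⁺` and a
pair `(w, π)` such that: `w` is singular at the origin, every slice of `w`, `π` is axisymmetric,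
and for every `a > 0`, `(w, π)` is a suitable weak solution in `Q(a)` (Albritton–Barker's class),
`w ∈ L³(Q(a))`, the rescaled velocities `λⱼ v(λⱼ² s, λⱼ y)` converge to `w` in `L³(Q(a))` and the
rescaled pressures weakly (against `L³`) to `π`, `A, C, D ≤ K`, `A + E ≤ K` for a weak spatial
gradient on `Q(2a)`, `C(a) ≥ κ` ((2.9)), and `|swirl (w s) y| ≤ c` for a.e. `(s, y) ∈ Q(a)`
((2.8): `Γ = ϱ u_φ ∈ L_∞(Q₋)`). The swirl bound (2.6) of the original solution, needed for (2.8),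
is `swirl_ae_bounded_half`. [cite: Seregin2020, proof of Thm 2.1, properties (𝒜), (2.8), (2.9)] -/
theorem exists_ancientLimit_isAxisymmetric_swirl_bounded :
    ∀ (u : ℝ → EuclideanSpace ℝ (Fin 3) → EuclideanSpace ℝ (Fin 3))
      (p : ℝ → EuclideanSpace ℝ (Fin 3) → ℝ)
      (G : ℝ → EuclideanSpace ℝ (Fin 3) → EuclideanSpace ℝ (Fin 3) →L[ℝ] EuclideanSpace ℝ (Fin 3)),
      IsSuitableWeakSolutionOn (SereginSverak2009.parCylOpens 0 1) 1 0 u p →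
      (∃ C : ℝ≥0, ∀ᵐ t ∂(volume.restrict (Ioo (-1 : ℝ) 0)),
        ∫⁻ x in SereginSverak2009.spaceCyl 0 1, ‖u t x‖ₑ ^ 2 ≤ C) →
      HasWeakSpatialGradientOn (SereginSverak2009.parCylOpens 0 1) u G →
      (∫⁻ z in SereginSverak2009.parCyl 0 1, ENNReal.ofReal (frobeniusNormSq (G z.1 z.2)) < ∞) →
      (∫⁻ z in SereginSverak2009.parCyl 0 1, ‖p z.1 z.2‖ₑ ^ (3 / 2 : ℝ) < ∞) →
      (∀ t ∈ Ioo (-1 : ℝ) 0, IsAxisymmetric (u t)) →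
      (∀ t ∈ Ioo (-1 : ℝ) 0, IsAxisymmetricScalar (p t)) →
      IsBackwardSingularPoint u 0 → Seregin2020.blowupIndex 0 u G < ∞ →
      ∃ (c : ℝ) (K : ℝ≥0) (κ : ℝ) (lam : ℕ → ℝ)
        (w : ℝ → EuclideanSpace ℝ (Fin 3) → EuclideanSpace ℝ (Fin 3))
        (π : ℝ → EuclideanSpace ℝ (Fin 3) → ℝ),
        0 < κ ∧ (∀ j, 0 < lam j) ∧ Tendsto lam atTop (𝓝 0) ∧
        IsBackwardSingularPoint w 0 ∧
        (∀ s, IsAxisymmetric (w s)) ∧ (∀ s, IsAxisymmetricScalar (π s)) ∧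
        ∀ a : ℝ, 0 < a →
          IsSuitableWeakSolutionInBall a 0 w π ∧
          MemLp (uncurry w) 3
            (volume.restrict (parabolicCylinder a (0 : ℝ × EuclideanSpace ℝ (Fin 3)))) ∧
          Tendsto (fun j => eLpNorm
              (uncurry ((lam j) • stPull ((lam j) ^ 2) (lam j) (0 : ℝ)
                (0 : EuclideanSpace ℝ (Fin 3)) u) - uncurry w) 3
              (volume.restrict (parabolicCylinder a (0 : ℝ × EuclideanSpace ℝ (Fin 3)))))
            atTop (𝓝 0) ∧
          (∀ g : ℝ × EuclideanSpace ℝ (Fin 3) → ℝ,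
            MemLp g 3 (volume.restrict (parabolicCylinder a (0 : ℝ × EuclideanSpace ℝ (Fin 3)))) →
            Tendsto (fun j => ∫ w' in parabolicCylinder a (0 : ℝ × EuclideanSpace ℝ (Fin 3)),
                ((lam j) ^ 2 • stPull ((lam j) ^ 2) (lam j) (0 : ℝ)
                  (0 : EuclideanSpace ℝ (Fin 3)) p) w'.1 w'.2 * g w')
              atTop (𝓝 (∫ w' in parabolicCylinder a (0 : ℝ × EuclideanSpace ℝ (Fin 3)),
                π w'.1 w'.2 * g w'))) ∧
          cknAEss a (0 : ℝ × EuclideanSpace ℝ (Fin 3)) w ≤ K ∧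
          cknC a (0 : ℝ × EuclideanSpace ℝ (Fin 3)) w ≤ K ∧
          cknD a (0 : ℝ × EuclideanSpace ℝ (Fin 3)) π ≤ K ∧
          (∃ G' : ℝ → EuclideanSpace ℝ (Fin 3) → EuclideanSpace ℝ (Fin 3) →L[ℝ] EuclideanSpace ℝ (Fin 3),
            HasWeakSpatialGradientOn
                (parabolicCylinderOpens (2 * a) (0 : ℝ × EuclideanSpace ℝ (Fin 3))) w G' ∧
              cknAEss a (0 : ℝ × EuclideanSpace ℝ (Fin 3)) w +
                cknE a (0 : ℝ × EuclideanSpace ℝ (Fin 3)) G' ≤ K) ∧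
          ENNReal.ofReal κ ≤ cknC a (0 : ℝ × EuclideanSpace ℝ (Fin 3)) w ∧
          ∀ᵐ z ∂(volume.restrict (parabolicCylinder a (0 : ℝ × EuclideanSpace ℝ (Fin 3)))),
            |swirl (w z.1) z.2| ≤ c := by
  intro u p G hsw hA hG hE hp hu_ax hp_ax hsing hI
  obtain ⟨c, hσ⟩ := swirl_ae_bounded_half u p G hsw hA hG hE hp hu_ax hp_ax
  exact ⟨c, exists_ancientLimit_isAxisymmetric_swirl_le hsw hA hG hE hp hu_ax hp_ax hsing hI hσ⟩

end Summit.NavierStokesRegularity.NavierStokesRegularity.Theorems.AxisymmetricKatoGlobal.EulerScaling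

end
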